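import Literature.Probability.RandomPlanarGeometry.LoewnerFlow
import Literature.Analysis.Complex.HalfPlaneRigidity
import HarnessLib

/-!
# Growth of the Loewner hulls: far field, the flow cocycle, and strict monotonicity

Trunk T-STOCH. Quantitative and structural properties of the chordal Loewner chain driven by a
continuous function `W` (Lawler (2005), Ch. 4 §4.1), on top of the flow API of
`LoewnerChainProofs` and the conformality/backward flow of `LoewnerFlow`:

* **Far field** (`Literature.Loewner.le_norm_sub_of_far`, a bootstrap/first-exit argument for the ODE):
  if `|z - c| ≥ M + 2δ` where `|W - c| ≤ M` on `[0, t]` and `δ² ≥ 4t`, then the flow of `z`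
  stays `δ`-away from the driving function on `[0, t]`, moves by at most `2t/δ ≤ δ/2`, and in
  particular `z` is not swallowed by time `t`. Consequences: the named fact
  `Literature.Probability.RandomPlanarGeometry.Loewner.tendsto_map_sub_self` (**hydrodynamic normalisation** `gₜ(z) - z → 0`,
  `tendsto_map_sub_self_holds`), the **size of the hulls** `Kₜ ⊆ B(c, M + 2δ)` (Lawler's
  Lemma 4.13, `norm_sub_lt_of_mem_hull`), and the same estimates for the backward map
  `fₜ = gₜ⁻¹` (`norm_invFunOn_map_sub_self_le`).
* **The cocycle** (`Literature.Loewner.shift W t = W (t + ·)`): for `z ∈ Hₜ`,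
  `t + r < T_z ↔ r < T^{W(t+·)}_{gₜ z}` and `g_{t+r} = g^{W(t+·)}_r ∘ gₜ`
  (`coe_add_lt_swallowingTime_iff`, `map_add`; Lawler (2005), Rem. 4.9), by restriction and
  concatenation of solutions.
* **Strict growth.** `Kᵣ ≠ ∅` for `r > 0` (`hull_nonempty`): otherwise `gᵣ` would be a conformal
  automorphism of `ℍₒ` with `gᵣ(z) - z → 0`, hence the identity by the rigidity theorem
  `Complex.eqOn_id_of_tendsto_sub_self` (`Literature.Analysis.Complex.HalfPlaneRigidity`),
  whereas `im gᵣ(z) < im z`. With the cocycle: `Kₜ ⊊ Kₛ` for `t < s`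
  (`exists_mem_hull_notMem_hull`).

## References

* G. F. Lawler, *Conformally Invariant Processes in the Plane*, AMS (2005), Ch. 4 §4.1:
  Thm. 4.6, Rem. 4.9 (the maps `g_{s,t}`), Lemma 4.13 (`rad Kₜ ≤ 4 max(√t, sup |U|)`).
-/

noncomputable section

open Set Filter Topology Metric Complex Bornology
open UpperHalfPlane (upperHalfPlaneSet isOpen_upperHalfPlaneSet)
open scoped NNReal

namespace Literature.Probability.RandomPlanarGeometry

namespace Loewner

variable {W : ℝ≥0 → ℝ} {z : ℂ} {g : ℝ → ℂ} {T : WithTop ℝ≥0}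

/-! ### The bootstrap lemma -/

/-- **First-exit bootstrap for Loewner-type flows.** Let `f` be continuous on `[0, b]` with right
derivatives of norm `≤ 2 / ‖f v - V v‖` on `[0, b)`, where the "driver" `V` is continuous on
`[0, b]` and stays within `M` of a centre `c`. If `‖f 0 - c‖ ≥ M + 2δ` with `δ > 0` and
`4b ≤ δ²`, then on `[0, b]` the path stays `δ`-away from the driver and moves by at most `2v/δ`.
(At the first time the distance drops to `δ` the displacement is `≤ 2b/δ ≤ δ/2`, so the
distance is still `≥ 3δ/2`.) Lawler (2005), proof of Lemma 4.13. [cite: Lawler2005, Lemma 4.13] -/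
theorem le_norm_sub_of_far_aux {f V : ℝ → ℂ} {f' : ℝ → ℂ} {b : ℝ} {c : ℂ} {M δ : ℝ}
    (hfc : ContinuousOn f (Icc 0 b)) (hVc : ContinuousOn V (Icc 0 b))
    (hf' : ∀ v ∈ Ico 0 b, HasDerivWithinAt f (f' v) (Ici v) v)
    (hbound : ∀ v ∈ Ico 0 b, ‖f' v‖ ≤ 2 / ‖f v - V v‖)
    (hM : ∀ v ∈ Icc 0 b, ‖V v - c‖ ≤ M) (hδ : 0 < δ) (hδb : 4 * b ≤ δ ^ 2)
    (hfar : M + 2 * δ ≤ ‖f 0 - c‖) :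
    ∀ v ∈ Icc 0 b, δ ≤ ‖f v - V v‖ ∧ ‖f v - f 0‖ ≤ 2 / δ * v := by
  -- displacement bound from a distance bound on an initial segment
  have hdisp : ∀ u ∈ Icc 0 b, (∀ v ∈ Ico 0 u, δ ≤ ‖f v - V v‖) → ‖f u - f 0‖ ≤ 2 / δ * u := by
    intro u hu hfaru
    have h := norm_image_sub_le_of_norm_deriv_right_le_segment (f := f) (f' := f') (a := 0)
      (b := u) (C := 2 / δ) (hfc.mono (Icc_subset_Icc_right hu.2))
      (fun v hv ↦ hf' v ⟨hv.1, hv.2.trans_le hu.2⟩)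
      (fun v hv ↦ (hbound v ⟨hv.1, hv.2.trans_le hu.2⟩).trans
        (div_le_div_of_nonneg_left (by norm_num) hδ (hfaru v hv))) u ⟨hu.1, le_rfl⟩
    simpa using h
  -- distance bound from the displacement bound
  have hdist : ∀ u ∈ Icc 0 b, ‖f u - f 0‖ ≤ 2 / δ * u → δ < ‖f u - V u‖ := by
    intro u hu hd
    have h1 : 2 / δ * u ≤ δ / 2 := by
      rw [div_mul_eq_mul_div, div_le_div_iff₀ hδ (by norm_num : (0 : ℝ) < 2)]
      nlinarith [hu.2, hu.1]
    have h2 : ‖f 0 - c‖ ≤ ‖f u - V u‖ + ‖f u - f 0‖ + ‖V u - c‖ := by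
      calc ‖f 0 - c‖ = ‖(f u - V u) - (f u - f 0) + (V u - c)‖ := by ring_nf
        _ ≤ ‖(f u - V u) - (f u - f 0)‖ + ‖V u - c‖ := norm_add_le _ _
        _ ≤ ‖f u - V u‖ + ‖f u - f 0‖ + ‖V u - c‖ := by gcongr; exact norm_sub_le _ _
    have h3 := hM u hu
    linarith
  -- no first bad time
  have hall : ∀ v ∈ Icc 0 b, δ < ‖f v - V v‖ := by
    by_contra hcon
    push Not at hcon
    set B : Set ℝ := {v ∈ Icc 0 b | ‖f v - V v‖ ≤ δ} with hB
    have hBne : B.Nonempty := by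
      obtain ⟨v, hv, hle⟩ := hcon
      exact ⟨v, hv, hle⟩
    have hBclosed : IsClosed B := by
      have hcont : ContinuousOn (fun v ↦ ‖f v - V v‖) (Icc 0 b) := (hfc.sub hVc).norm
      exact hcont.preimage_isClosed_of_isClosed isClosed_Icc isClosed_Iic
    have hBbdd : BddBelow B := ⟨0, fun v hv ↦ hv.1.1⟩
    set v₀ := sInf B with hv₀
    have hv₀B : v₀ ∈ B := hBclosed.csInf_mem hBne hBbdd
    have hbefore : ∀ v ∈ Ico 0 v₀, δ ≤ ‖f v - V v‖ := by
      intro v hv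
      by_contra hlt
      rw [not_le] at hlt
      have hvB : v ∈ B := ⟨⟨hv.1, hv.2.le.trans hv₀B.1.2⟩, hlt.le⟩
      exact (lt_irrefl _ (hv.2.trans_le (csInf_le hBbdd hvB)))
    have h1 := hdist v₀ hv₀B.1 (hdisp v₀ hv₀B.1 hbefore)
    exact (lt_irrefl _ (h1.trans_le hv₀B.2))
  intro v hv
  exact ⟨(hall v hv).le, hdisp v hv fun u hu ↦ (hall u ⟨hu.1, hu.2.le.trans hv.2⟩).le⟩

/-! ### Far field for the forward flow -/

/-- **Far points are not swallowed and barely move.** Let `W` be continuous with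
`|W u - c| ≤ M` for `u ∈ [0, t]`, let `δ > 0` with `4t ≤ δ²`, and `|z - c| ≥ M + 2δ`, `z ≠ W 0`
automatic. Then `t < T_z` and, for every `s ≤ t`, the flow stays `δ`-away from `W` and
`|gₛ(z) - z| ≤ 2s/δ (≤ δ/2)`. Lawler (2005), Lemma 4.13 ("if `|z| > 4Rₜ` then
`|gₛ(z) - z| ≤ Rₜ`"). [cite: Lawler2005, Lemma 4.13] -/
theorem lt_swallowingTime_of_far (hW : Continuous W) {t : ℝ≥0} {c : ℂ} {M δ : ℝ}
    (hM : ∀ u ∈ Icc (0 : ℝ) t, ‖(W u.toNNReal : ℂ) - c‖ ≤ M) (hδ : 0 < δ)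
    (hδt : 4 * (t : ℝ) ≤ δ ^ 2) (hfar : M + 2 * δ ≤ ‖z - c‖) :
    (t : WithTop ℝ≥0) < swallowingTime W z ∧
      ∀ s : ℝ≥0, s ≤ t → δ ≤ ‖map W s z - W s‖ ∧ ‖map W s z - z‖ ≤ 2 / δ * s := by
  have hM0 : ‖(W 0 : ℂ) - c‖ ≤ M := by simpa using hM 0 ⟨le_rfl, t.coe_nonneg⟩
  have hz : z ≠ W 0 := by
    intro h
    rw [h] at hfar
    linarith [hM0]
  obtain ⟨G, hG⟩ := exists_isSolution_swallowingTime_holds hW hz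
  -- the bootstrap on every compact initial segment of the lifetime
  have key : ∀ b : ℝ, 0 ≤ b → b ≤ t → (b.toNNReal : WithTop ℝ≥0) < swallowingTime W z →
      ∀ v ∈ Icc 0 b, δ ≤ ‖G v - W v.toNNReal‖ ∧ ‖G v - G 0‖ ≤ 2 / δ * v := by
    intro b hb0 hbt hbT
    have hsub := Icc_subset_timeDomain (T := swallowingTime W z) hbT
    refine le_norm_sub_of_far_aux (V := fun v ↦ (W v.toNNReal : ℂ)) (f' := fun v ↦ vectorField W v (G v))
      (hG.continuousOn.mono hsub) ?_ (hG.hasDerivWithinAt_Ici hsub) (fun v _ ↦ ?_)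
      (fun v hv ↦ hM v ⟨hv.1, hv.2.trans hbt⟩) hδ (by linarith) (by rwa [hG.apply_zero])
    · exact (Complex.continuous_ofReal.comp (hW.comp continuous_real_toNNReal)).continuousOn
    · rw [vectorField_apply, norm_div, RCLike.norm_ofNat]
  -- the lifetime exceeds `t`
  have hlt : (t : WithTop ℝ≥0) < swallowingTime W z := by
    by_contra hle
    rw [not_lt] at hle
    -- the lifetime is a finite `b ≤ t`, positive
    obtain ⟨b, hb⟩ : ∃ b : ℝ≥0, swallowingTime W z = b := by
      induction hT : swallowingTime W z with
      | top => exact absurd hle (by rw [hT]; exact not_le.2 (WithTop.coe_lt_top t))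
      | coe b => exact ⟨b, rfl⟩
    rw [hb] at hle hG
    have hbpos : 0 < b := by
      have := swallowingTime_pos_holds hW hz
      rw [hb] at this
      exact_mod_cast this
    have hbt : (b : ℝ) ≤ t := by exact_mod_cast (WithTop.coe_le_coe.1 hle)
    -- `δ`-away on `[0, b)`: apply the bootstrap on `[0, b']` for every `b' < b`
    have hfarb : ∀ v : ℝ, 0 ≤ v → v < b → δ ≤ ‖G v - W v.toNNReal‖ := by
      intro v hv0 hvb
      have hvT : (v.toNNReal : WithTop ℝ≥0) < (b : WithTop ℝ≥0) := by
        rw [WithTop.coe_lt_coe, ← NNReal.coe_lt_coe, Real.coe_toNNReal _ hv0]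
        exact hvb
      rw [← hb] at hvT
      exact (key v hv0 (hvb.le.trans hbt) hvT v ⟨hv0, le_rfl⟩).1
    have := hG.coe_lt_swallowingTime_of_le_norm_sub hW hbpos (δ := ⟨δ, hδ.le⟩) hδ hfarb
    rw [hb] at this
    exact lt_irrefl _ this
  refine ⟨hlt, fun s hs ↦ ?_⟩
  have hsT : (((s : ℝ)).toNNReal : WithTop ℝ≥0) < swallowingTime W z := by
    simpa using lt_of_le_of_lt (WithTop.coe_le_coe.2 hs) hlt
  have hsT' : (s : WithTop ℝ≥0) < swallowingTime W z := lt_of_le_of_lt (WithTop.coe_le_coe.2 hs) hlt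
  have h := key s s.coe_nonneg (by exact_mod_cast hs) hsT s ⟨s.coe_nonneg, le_rfl⟩
  rw [map_eq_of_isSolution hW hG hsT', ← hG.apply_zero]
  simpa using h


/-- A continuous driving function is bounded on `[0, t]` (about any centre). [folklore] -/
theorem exists_forall_norm_driving_sub_le (hW : Continuous W) (t : ℝ≥0) (c : ℂ) :
    ∃ M : ℝ, 0 ≤ M ∧ ∀ u ∈ Icc (0 : ℝ) t, ‖(W u.toNNReal : ℂ) - c‖ ≤ M := by
  have hcont : Continuous fun u : ℝ ↦ (W u.toNNReal : ℂ) - c :=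
    (Complex.continuous_ofReal.comp (hW.comp continuous_real_toNNReal)).sub continuous_const
  obtain ⟨C, hC⟩ := isCompact_Icc.exists_bound_of_continuousOn (hcont.continuousOn (s := Icc (0 : ℝ) t))
  exact ⟨max C 0, le_max_right _ _, fun u hu ↦ (hC u hu).trans (le_max_left _ _)⟩

/-- The radius beyond which points move by less than `ε` up to time `t`: with
`δ = 2√t + 2t/ε + 1` one has `δ > 0`, `4t ≤ δ²` and `2t/δ < ε`. [folklore] -/
theorem exists_delta (t : ℝ≥0) {ε : ℝ} (hε : 0 < ε) :
    ∃ δ : ℝ, 0 < δ ∧ 4 * (t : ℝ) ≤ δ ^ 2 ∧ 2 / δ * t < ε := by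
  refine ⟨2 * Real.sqrt t + 2 * t / ε + 1, by positivity, ?_, ?_⟩
  · have h1 : Real.sqrt t ^ 2 = t := Real.sq_sqrt t.coe_nonneg
    nlinarith [Real.sqrt_nonneg (t : ℝ), t.coe_nonneg, (by positivity : (0 : ℝ) ≤ 2 * t / ε)]
  · have hδ : (0 : ℝ) < 2 * Real.sqrt t + 2 * t / ε + 1 := by positivity
    rw [div_mul_eq_mul_div, div_lt_iff₀ hδ]
    have : 2 * (t : ℝ) = ε * (2 * t / ε) := by field_simp
    nlinarith [Real.sqrt_nonneg (t : ℝ), t.coe_nonneg, hε.le]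

/-- **`Literature.Probability.RandomPlanarGeometry.Loewner.tendsto_map_sub_self` holds: the hydrodynamic normalisation
`gₜ(z) - z → 0` as `z → ∞` in `ℍₒ`** (continuous driving function). Lawler (2005), Thm. 4.6
and Lemma 4.13. [cite: Lawler2005, Lemma 4.13] -/
theorem tendsto_map_sub_self_holds : tendsto_map_sub_self (W := W) := by
  intro hW t
  refine Metric.tendsto_nhds.2 fun ε hε ↦ ?_
  obtain ⟨M, -, hM⟩ := exists_forall_norm_driving_sub_le hW t 0
  obtain ⟨δ, hδ, hδt, hδε⟩ := exists_delta t hε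
  rw [← cobounded_eq_cocompact]
  refine ((hasBasis_cobounded_compl_closedBall (0 : ℂ)).inf_principal _).eventually_iff.2
    ⟨M + 2 * δ, trivial, fun z hz ↦ ?_⟩
  have hzR : M + 2 * δ ≤ ‖z - 0‖ := by
    have := hz.1
    rw [mem_compl_iff, mem_closedBall, not_le, dist_zero_right] at this
    simpa using this.le
  have h := (lt_swallowingTime_of_far hW hM hδ hδt hzR).2 t le_rfl
  rw [dist_zero_right]
  exact h.2.trans_lt hδε

/-- **Size of the hulls** (Lawler's Lemma 4.13): if `|W u - c| ≤ M` on `[0, t]`, `δ > 0` and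
`4t ≤ δ²`, then `Kₜ ⊆ B(c, M + 2δ)`. [cite: Lawler2005, Lemma 4.13] -/
theorem norm_sub_lt_of_mem_hull (hW : Continuous W) {t : ℝ≥0} {c : ℂ} {M δ : ℝ}
    (hM : ∀ u ∈ Icc (0 : ℝ) t, ‖(W u.toNNReal : ℂ) - c‖ ≤ M) (hδ : 0 < δ)
    (hδt : 4 * (t : ℝ) ≤ δ ^ 2) (hz : z ∈ hull W t) : ‖z - c‖ < M + 2 * δ := by
  by_contra hle
  rw [not_lt] at hle
  exact (lt_irrefl _ ((lt_swallowingTime_of_far hW hM hδ hδt hle).1.trans_le hz.2))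

/-- Points of `ℍₒ` far away belong to the Loewner domain `Hₜ`. [cite: Lawler2005, Lemma 4.13] -/
theorem mem_domain_of_far (hW : Continuous W) {t : ℝ≥0} {c : ℂ} {M δ : ℝ}
    (hM : ∀ u ∈ Icc (0 : ℝ) t, ‖(W u.toNNReal : ℂ) - c‖ ≤ M) (hδ : 0 < δ)
    (hδt : 4 * (t : ℝ) ≤ δ ^ 2) (hzH : z ∈ upperHalfPlaneSet) (hfar : M + 2 * δ ≤ ‖z - c‖) :
    z ∈ domain W t :=
  (mem_domain_iff W t z).2 ⟨hzH, (lt_swallowingTime_of_far hW hM hδ hδt hfar).1⟩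

/-! ### Far field for the backward flow -/

/-- The backward map `fₜ = gₜ⁻¹` is given by any backward solution: if `h` solves the
time-reversed equation on `[0, t]` off the real line with `h 0 = w ∈ ℍₒ`, `h t ∈ Hₜ` and
`gₜ (h t) = w`, then `fₜ w = h t`. [folklore] -/
theorem invFunOn_map_eq (hW : Continuous W) {t : ℝ≥0} {w x : ℂ} (hw : w ∈ upperHalfPlaneSet)
    (hx : x ∈ domain W t) (hmap : map W t x = w) :
    Function.invFunOn (map W t) (domain W t) w = x := by
  have hinv := (bijOn_map hW t).invOn_invFunOn
  refine injOn_map hW t ((bijOn_map hW t).surjOn.mapsTo_invFunOn hw) hx ?_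
  rw [hinv.2 hw, hmap]

/-- **Far field for the backward map**: if `|W u - c| ≤ M` on `[0, t]`, `δ > 0`, `4t ≤ δ²` and
`w ∈ ℍₒ` with `|w - c| ≥ M + 2δ`, then `|fₜ(w) - w| ≤ 2t/δ`. (The same bootstrap for the
time-reversed equation.) Lawler (2005), Lemma 4.13 / eq. (4.12). [cite: Lawler2005, Lemma 4.13] -/
theorem norm_invFunOn_map_sub_self_le (hW : Continuous W) {t : ℝ≥0} {c : ℂ} {M δ : ℝ}
    (hM : ∀ u ∈ Icc (0 : ℝ) t, ‖(W u.toNNReal : ℂ) - c‖ ≤ M) (hδ : 0 < δ)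
    (hδt : 4 * (t : ℝ) ≤ δ ^ 2) {w : ℂ} (hw : w ∈ upperHalfPlaneSet) (hfar : M + 2 * δ ≤ ‖w - c‖) :
    ‖Function.invFunOn (map W t) (domain W t) w - w‖ ≤ 2 / δ * t := by
  have hw' : 0 < w.im := hw
  set m : ℝ≥0 := ⟨w.im / 2, by positivity⟩
  have hm : 0 < m := by
    change (0 : ℝ) < w.im / 2
    positivity
  have hmw : (m : ℝ) < w.im := by
    change w.im / 2 < w.im
    linarith
  obtain ⟨h, h0, hc, hd, him, hdom, hmap⟩ := exists_backward_solution hW t hm hmw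
  rw [invFunOn_map_eq hW hw hdom hmap]
  have hm' : (0 : ℝ) < m := hm
  have key := le_norm_sub_of_far_aux (f := h) (V := fun s ↦ (W (((t : ℝ) - s).toNNReal) : ℂ))
    (f' := fun s ↦ -vectorField W ((t : ℝ) - s) (h s)) (b := t) (c := c) (M := M) (δ := δ)
    hc.continuousOn ?_ ?_ ?_ ?_ hδ hδt (by rwa [h0]) t ⟨t.coe_nonneg, le_rfl⟩
  · rw [h0] at key
    exact key.2
  · exact (Complex.continuous_ofReal.comp (hW.comp (continuous_real_toNNReal.comp
      (continuous_const.sub continuous_id)))).continuousOn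
  · intro s hs
    exact ((hd s ⟨hs.1, hs.2.le⟩).mono (Icc_subset_Icc_left (by linarith [hs.1]) :
      Icc s (t : ℝ) ⊆ Icc (-1 : ℝ) t)).mono_of_mem_nhdsWithin (Icc_mem_nhdsGE hs.2)
  · intro s _
    rw [norm_neg, vectorField_apply, norm_div, RCLike.norm_ofNat]
  · intro s hs
    exact hM ((t : ℝ) - s) ⟨by linarith [hs.2], by linarith [hs.1]⟩

/-- **Hydrodynamic normalisation of the backward map**: `fₜ(w) - w → 0` as `w → ∞` in `ℍₒ`.
Lawler (2005), eq. (4.12) ff. [cite: Lawler2005, Lemma 4.13] -/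
theorem tendsto_invFunOn_map_sub_self (hW : Continuous W) (t : ℝ≥0) :
    Tendsto (fun w ↦ Function.invFunOn (map W t) (domain W t) w - w)
      (cocompact ℂ ⊓ 𝓟 upperHalfPlaneSet) (𝓝 0) := by
  refine Metric.tendsto_nhds.2 fun ε hε ↦ ?_
  obtain ⟨M, -, hM⟩ := exists_forall_norm_driving_sub_le hW t 0
  obtain ⟨δ, hδ, hδt, hδε⟩ := exists_delta t hε
  rw [← cobounded_eq_cocompact]
  refine ((hasBasis_cobounded_compl_closedBall (0 : ℂ)).inf_principal _).eventually_iff.2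
    ⟨M + 2 * δ, trivial, fun w hw ↦ ?_⟩
  have hwR : M + 2 * δ ≤ ‖w - 0‖ := by
    have := hw.1
    rw [mem_compl_iff, mem_closedBall, not_le, dist_zero_right] at this
    simpa using this.le
  rw [dist_zero_right]
  exact (norm_invFunOn_map_sub_self_le hW hM hδ hδt hw.2 hwR).trans_lt hδε


/-! ### The cocycle: restriction to `[t, ∞)` and the shifted driving function `W (t + ·)` -/

section Cocycle

variable {G : ℝ → ℂ}

/-- Time domain of the shifted lifetime `T.map (· - t)`: for `u ≥ 0` and `t < T`,
`u < T - t ↔ t + u < T`. [folklore] -/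
theorem toNNReal_lt_map_sub_iff {t : ℝ≥0} (ht : (t : WithTop ℝ≥0) < T) {u : ℝ} (hu : 0 ≤ u) :
    (u.toNNReal : WithTop ℝ≥0) < T.map (· - t) ↔ (((t : ℝ) + u).toNNReal : WithTop ℝ≥0) < T := by
  induction T with
  | top =>
    simp only [WithTop.map_top]
    exact ⟨fun _ ↦ WithTop.coe_lt_top _, fun _ ↦ WithTop.coe_lt_top _⟩
  | coe b =>
    have htb : t < b := WithTop.coe_lt_coe.1 ht
    rw [WithTop.map_coe, WithTop.coe_lt_coe, WithTop.coe_lt_coe, ← NNReal.coe_lt_coe,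
      ← NNReal.coe_lt_coe, Real.coe_toNNReal _ hu, Real.coe_toNNReal _ (by positivity),
      NNReal.coe_sub htb.le]
    constructor <;> intro h <;> linarith

/-- **Restriction of a solution to `[t, ∞)`** solves the equation driven by `W (t + ·)` from
`G t`, with lifetime `T - t`. Lawler (2005), Rem. 4.9. [cite: Lawler2005, Rem. 4.9] -/
theorem IsSolution.shift (h : IsSolution W z G T) {t : ℝ≥0} (ht : (t : WithTop ℝ≥0) < T) :
    IsSolution (fun u ↦ W (t + u)) (G t) (fun u ↦ G ((t : ℝ) + u)) (T.map (· - t)) := by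
  refine ⟨by simp, fun u hu ↦ ?_, fun u hu0 huT ↦ ?_⟩
  · have hu' : (((t : ℝ) + u).toNNReal : WithTop ℝ≥0) < T := (toNNReal_lt_map_sub_iff ht hu.1).1 hu.2
    have htu : 0 ≤ (t : ℝ) + u := add_nonneg t.coe_nonneg hu.1
    have h1 := h.isIntegralCurveOn ((t : ℝ) + u) ⟨htu, hu'⟩
    have h2 : HasDerivWithinAt (fun u : ℝ ↦ (t : ℝ) + u) (1 : ℝ)
        {u : ℝ | 0 ≤ u ∧ (u.toNNReal : WithTop ℝ≥0) < T.map (· - t)} u := by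
      simpa using ((hasDerivAt_id u).const_add (t : ℝ)).hasDerivWithinAt
    have hmaps : MapsTo (fun u : ℝ ↦ (t : ℝ) + u)
        {u : ℝ | 0 ≤ u ∧ (u.toNNReal : WithTop ℝ≥0) < T.map (· - t)}
        {s : ℝ | 0 ≤ s ∧ (s.toNNReal : WithTop ℝ≥0) < T} := fun v hv ↦
      ⟨add_nonneg t.coe_nonneg hv.1, (toNNReal_lt_map_sub_iff ht hv.1).1 hv.2⟩
    have h3 := h1.scomp u h2 hmaps
    rw [one_smul] at h3
    have heq : vectorField W ((t : ℝ) + u) (G ((t : ℝ) + u)) =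
        vectorField (fun v ↦ W (t + v)) u (G ((t : ℝ) + u)) := by
      rw [vectorField_apply, vectorField_apply, Real.toNNReal_add t.coe_nonneg hu.1, Real.toNNReal_coe]
    rw [heq] at h3
    exact h3
  · have hu' : (((t : ℝ) + u).toNNReal : WithTop ℝ≥0) < T := (toNNReal_lt_map_sub_iff ht hu0).1 huT
    have := h.ne (t := (t : ℝ) + u) (add_nonneg t.coe_nonneg hu0) hu'
    rwa [Real.toNNReal_add t.coe_nonneg hu0, Real.toNNReal_coe] at this

variable (W) in
/-- The shifted driving function `W (t + ·)` is continuous if `W` is. [folklore] -/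
theorem continuous_shift (hW : Continuous W) (t : ℝ≥0) : Continuous fun u ↦ W (t + u) :=
  hW.comp (continuous_const.add continuous_id)

/-- **The cocycle, forward half**: if `t + r < T_z` then `r < T^{W(t+·)}_{gₜ z}` and
`g_{t+r}(z) = g^{W(t+·)}_r (gₜ z)`. Lawler (2005), Rem. 4.9 (`g_{s+t} = g_{s,s+t} ∘ g_s`).
[cite: Lawler2005, Rem. 4.9] -/
theorem map_add (hW : Continuous W) {t r : ℝ≥0}
    (htr : ((t + r : ℝ≥0) : WithTop ℝ≥0) < swallowingTime W z) :
    (r : WithTop ℝ≥0) < swallowingTime (fun u ↦ W (t + u)) (map W t z) ∧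
      map W (t + r) z = map (fun u ↦ W (t + u)) r (map W t z) := by
  have ht : (t : WithTop ℝ≥0) < swallowingTime W z :=
    lt_of_le_of_lt (by exact_mod_cast (le_self_add : t ≤ t + r)) htr
  have hz : z ≠ W 0 := ne_driving_of_lt_swallowingTime ht
  obtain ⟨G, hG⟩ := exists_isSolution_swallowingTime_holds hW hz
  have hsh := hG.shift ht
  have hr : (r : WithTop ℝ≥0) < (swallowingTime W z).map (· - t) := by
    have := (toNNReal_lt_map_sub_iff (T := swallowingTime W z) ht r.coe_nonneg).2
      (by simpa using htr)
    simpa using this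
  rw [map_eq_of_isSolution hW hG ht, map_eq_of_isSolution hW hG htr]
  refine ⟨hr.trans_le hsh.le_swallowingTime, ?_⟩
  rw [map_eq_of_isSolution (continuous_shift W hW t) hsh hr]
  push_cast
  ring_nf

/-- **The cocycle, backward half**: for `z ∈ Hₜ`, if `r < T^{W(t+·)}_{gₜ z}` then `t + r < T_z`.
(If `T_z = b ≤ t + r`, the maximal solution from `z` comes arbitrarily close to `W` before `b`,
necessarily after time `t`; but on `[t, b]` it is the restriction of the maximal shifted
solution, which is alive beyond `b - t` and stays away from `W (t + ·)` there.)
Lawler (2005), Rem. 4.9. [cite: Lawler2005, Rem. 4.9] -/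
theorem coe_add_lt_swallowingTime (hW : Continuous W) {t r : ℝ≥0} (hzt : z ∈ domain W t)
    (hr : (r : WithTop ℝ≥0) < swallowingTime (fun u ↦ W (t + u)) (map W t z)) :
    ((t + r : ℝ≥0) : WithTop ℝ≥0) < swallowingTime W z := by
  rw [mem_domain_iff] at hzt
  have ht := hzt.2
  have hz : z ≠ W 0 := ne_driving_of_lt_swallowingTime ht
  obtain ⟨G, hG⟩ := exists_isSolution_swallowingTime_holds hW hz
  by_contra hle
  rw [not_lt] at hle
  obtain ⟨b, hb⟩ : ∃ b : ℝ≥0, swallowingTime W z = b := by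
    induction hT : swallowingTime W z with
    | top => exact absurd hle (by rw [hT]; exact not_le.2 (WithTop.coe_lt_top _))
    | coe b => exact ⟨b, rfl⟩
  rw [hb] at hle hG ht
  have htb : t < b := WithTop.coe_lt_coe.1 ht
  have hbtr : b ≤ t + r := WithTop.coe_le_coe.1 hle
  have hbpos : 0 < b := pos_of_gt htb
  -- the maximal shifted solution and its distance from the shifted driver on `[0, b - t]`
  set w := map W t z with hw
  have hwz : w ≠ W (t + 0) := ne_driving_of_lt_swallowingTime hr
  obtain ⟨G', hG'⟩ := exists_isSolution_swallowingTime_holds (continuous_shift W hW t) hwz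
  have htb' : (t : ℝ) < b := by exact_mod_cast htb
  have hbtr' : (b : ℝ) ≤ t + r := by exact_mod_cast hbtr
  have hbt' : (((b : ℝ) - t).toNNReal : WithTop ℝ≥0) < swallowingTime (fun u ↦ W (t + u)) w := by
    refine lt_of_le_of_lt ?_ hr
    rw [WithTop.coe_le_coe, ← NNReal.coe_le_coe, Real.coe_toNNReal _ (by linarith)]
    linarith
  obtain ⟨δ₁, hδ₁, hfar₁⟩ := hG'.exists_le_norm_sub (continuous_shift W hW t)
    (b := (b : ℝ) - t) (by linarith) hbt'
  -- distance of `G` from `W` on `[0, t]`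
  have htT : (((t : ℝ)).toNNReal : WithTop ℝ≥0) < (b : WithTop ℝ≥0) := by simpa using ht
  obtain ⟨δ₀, hδ₀, hfar₀⟩ := hG.exists_le_norm_sub hW t.coe_nonneg htT
  -- `G` restricted to `[t, b)` is the shifted solution, which agrees with `G'`
  have hsh := hG.shift ht
  have hw' : G t = w := by rw [hw, map_eq_of_isSolution hW hG ht]
  rw [hw'] at hsh
  -- a time where `G` is close to `W`
  obtain ⟨u, hu0, hub, hclose⟩ := hG.exists_norm_sub_lt hW hbpos hb
    (lt_min (NNReal.coe_pos.2 hδ₀) (NNReal.coe_pos.2 hδ₁) : (0 : ℝ) < min (δ₀ : ℝ) δ₁)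
  rcases le_or_gt u t with hut | hut
  · have := hfar₀ u ⟨hu0, hut⟩
    have hmin : min (δ₀ : ℝ) δ₁ ≤ δ₀ := min_le_left _ _
    linarith
  · -- `u = t + v` with `0 < v < b - t`
    set v : ℝ := u - t with hv
    have hv0 : 0 ≤ v := by rw [hv]; linarith
    have hvb : v < (b : ℝ) - t := by rw [hv]; linarith
    have heq : G u = G' v := by
      have hmem : v ∈ {s : ℝ | 0 ≤ s ∧ (s.toNNReal : WithTop ℝ≥0) <
          min ((b : WithTop ℝ≥0).map (· - t)) (swallowingTime (fun u ↦ W (t + u)) w)} := by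
        refine ⟨hv0, lt_min ?_ ?_⟩
        · rw [toNNReal_lt_map_sub_iff ht hv0, WithTop.coe_lt_coe, ← NNReal.coe_lt_coe,
            Real.coe_toNNReal _ (add_nonneg t.coe_nonneg hv0)]
          linarith
        · refine lt_of_le_of_lt ?_ hbt'
          exact WithTop.coe_le_coe.2 (Real.toNNReal_le_toNNReal hvb.le)
      have := IsSolution.eqOn_holds (continuous_shift W hW t) hsh hG' hmem
      have huv : (t : ℝ) + v = u := by rw [hv]; ring
      simpa [huv] using this
    have h1 := hfar₁ v ⟨hv0, hvb.le⟩
    rw [← heq] at h1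
    have h2 : W (t + v.toNNReal) = W u.toNNReal := by
      congr 1
      rw [← Real.toNNReal_coe (r := t), ← Real.toNNReal_add t.coe_nonneg hv0]
      congr 1; rw [hv]; ring
    rw [h2] at h1
    have hmin : min (δ₀ : ℝ) δ₁ ≤ δ₁ := min_le_right _ _
    linarith

/-- The cocycle on hulls: for `z ∈ Hₜ` and `t ≤ s`, `z ∈ Kₛ ↔ gₜ z ∈ K^{W(t+·)}_{s-t}`; i.e.
`Kₛ ∖ Kₜ = fₜ (K^{W(t+·)}_{s-t})`. Lawler (2005), Rem. 4.9 / §4.1 (`K_{s,t} = g_s(K_t ∖ K_s)`).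
[cite: Lawler2005, Rem. 4.9] -/
theorem mem_hull_iff_map_mem_hull (hW : Continuous W) {t s : ℝ≥0} (hzt : z ∈ domain W t)
    (hts : t ≤ s) : z ∈ hull W s ↔ map W t z ∈ hull (fun u ↦ W (t + u)) (s - t) := by
  have hwH : map W t z ∈ upperHalfPlaneSet := mapsTo_map hW t hzt
  have hzH : z ∈ upperHalfPlaneSet := domain_subset W t hzt
  have hs : t + (s - t) = s := add_tsub_cancel_of_le hts
  constructor
  · intro hzs
    refine ⟨hwH, not_lt.1 fun hlt ↦ ?_⟩
    have := coe_add_lt_swallowingTime hW hzt hlt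
    rw [hs] at this
    exact (lt_irrefl _ (this.trans_le hzs.2))
  · intro hws
    refine ⟨hzH, not_lt.1 fun hlt ↦ ?_⟩
    rw [← hs] at hlt
    exact (lt_irrefl _ ((map_add hW hlt).1.trans_le hws.2))

end Cocycle

/-! ### Strict growth of the hulls -/

/-- The imaginary part strictly decreases along the flow (positive times). [folklore] -/
theorem im_map_lt (hW : Continuous W) {t : ℝ≥0} (ht : 0 < t) (hz : z ∈ domain W t) :
    (map W t z).im < z.im := by
  rw [mem_domain_iff] at hz
  have hzH : 0 < z.im := hz.1
  obtain ⟨G, hG⟩ := exists_isSolution_swallowingTime_holds hW (ne_driving_of_lt_swallowingTime hz.2)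
  rw [map_eq_of_isSolution hW hG hz.2, ← hG.apply_zero]
  set D : Set ℝ := {s : ℝ | 0 ≤ s ∧ (s.toNNReal : WithTop ℝ≥0) < swallowingTime W z}
  have htT : (((t : ℝ)).toNNReal : WithTop ℝ≥0) < swallowingTime W z := by simpa using hz.2
  have hsub : Icc (0 : ℝ) t ⊆ D := Icc_subset_timeDomain htT
  have hy : ∀ s ∈ D, HasDerivWithinAt (fun s ↦ (G s).im)
      (-2 * (G s).im / Complex.normSq (G s - W s.toNNReal)) D s := fun s hs ↦ by
    have h2 : HasDerivWithinAt (fun s ↦ (G s).im) (vectorField W s (G s)).im D s :=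
      Complex.imCLM.hasFDerivAt.comp_hasDerivWithinAt s (hG.isIntegralCurveOn s hs)
    rwa [im_vectorField] at h2
  have hanti : StrictAntiOn (fun s ↦ (G s).im) (Icc (0 : ℝ) t) := by
    refine strictAntiOn_of_hasDerivWithinAt_neg (convex_Icc _ _)
      (fun s hs ↦ (hy s (hsub hs)).continuousWithinAt.mono hsub)
      (fun s hs ↦ (hy s (hsub (interior_subset hs))).mono (interior_subset.trans hsub))
      fun s hs ↦ ?_
    have hs' := hsub (interior_subset hs)
    have hpos : 0 < (G s).im := IsSolution.im_pos_holds hW hG hzH s hs'.1 hs'.2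
    have hns : 0 < Complex.normSq (G s - W s.toNNReal) :=
      Complex.normSq_pos.2 (sub_ne_zero.2 (hG.ne hs'.1 hs'.2))
    exact div_neg_of_neg_of_pos (by linarith) hns
  have ht' : (0 : ℝ) < t := ht
  exact hanti ⟨le_rfl, ht'.le⟩ ⟨ht'.le, le_rfl⟩ ht'

/-- **The hulls of a continuous driving function are never empty at positive times.**
Otherwise `gₜ` would be a holomorphic bijection `ℍₒ → ℍₒ` with `gₜ(z) - z → 0` and
`fₜ(w) - w → 0` at `∞`, hence the identity (`Complex.eqOn_id_of_tendsto_sub_self`), while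
`im gₜ(z) < im z`. (Equivalently `hcap Kₜ = 2t > 0`.) Lawler (2005), Ch. 4 §4.1, Thm. 4.6
(`gₜ(z) = z + 2t/z + …`). [cite: Lawler2005, Thm. 4.6] -/
theorem hull_nonempty (hW : Continuous W) {t : ℝ≥0} (ht : 0 < t) : (hull W t).Nonempty := by
  by_contra hemp
  rw [not_nonempty_iff_eq_empty] at hemp
  have hdom : domain W t = upperHalfPlaneSet := by simp [domain, hemp]
  have h1 := differentiableOn_map hW t
  have h2 := bijOn_map hW t
  have h3 := differentiableOn_invFunOn_map hW t
  have h4 := bijOn_invFunOn_map hW t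
  have h5 := tendsto_invFunOn_map_sub_self hW t
  have h6 := (bijOn_map hW t).invOn_invFunOn.1
  rw [hdom] at h1 h2 h3 h4 h5 h6
  have hid := Complex.eqOn_id_of_tendsto_sub_self h1 h2.mapsTo (tendsto_map_sub_self_holds hW t)
    h3 h4.mapsTo h5 h6
  have hI : I ∈ upperHalfPlaneSet := by simp [upperHalfPlaneSet]
  have hlt := im_map_lt hW ht (hdom ▸ hI)
  rw [hid hI] at hlt
  exact lt_irrefl _ hlt

/-- **Strict growth of the hulls**: for a continuous driving function and `t < s` there is a
point of `Kₛ` outside `Kₜ` (in fact in `Hₜ`): the shifted chain `W (t + ·)` has a non-empty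
hull at time `s - t`, and its preimage under `gₜ` is swallowed between `t` and `s`.
Lawler (2005), Ch. 4 §4.1. [cite: Lawler2005, Thm. 4.6] -/
theorem exists_mem_hull_diff_hull (hW : Continuous W) {t s : ℝ≥0} (hts : t < s) :
    ∃ z, z ∈ hull W s ∧ z ∈ domain W t := by
  obtain ⟨w, hw⟩ := hull_nonempty (continuous_shift W hW t) (tsub_pos_of_lt hts)
  have hwH : w ∈ upperHalfPlaneSet := hw.1
  obtain ⟨z, hz, hzw⟩ := surjOn_map hW t hwH
  refine ⟨z, ?_, hz⟩
  rw [mem_hull_iff_map_mem_hull hW hz hts.le, hzw]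
  exact hw

/-- Strict monotonicity of the hulls: `Kₜ ⊂ Kₛ` for `t < s`. [cite: Lawler2005, Thm. 4.6] -/
theorem hull_ssubset_hull (hW : Continuous W) {t s : ℝ≥0} (hts : t < s) : hull W t ⊂ hull W s := by
  refine (hull_mono W hts.le).ssubset_of_ne fun heq ↦ ?_
  obtain ⟨z, hzs, hzt⟩ := exists_mem_hull_diff_hull hW hts
  rw [← heq] at hzs
  exact hzt.2 hzs

end Loewner

end Literature.Probability.RandomPlanarGeometry
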